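import Mathlib
import HarnessLib

/-!
# `NoHeavyLowerTail` (crux stmt-CriticalPhenomena-4575), antithetic vdBHK programme: the rearrangement inequality (R) is AUTOMATIC for pairs of
# the SAME NESTING TYPE — violations of (R) on an antipodal-Kleitman base pair a nested configuration with an anti-nested one (or are crossing)

Support file (seat `prim-ineq-gen-7` gen 53; `--supports stmt-CriticalPhenomena-4575`).  No `sorry`, no definitions.  Memo: FINDING-UNCROSS-g53.md §1.

SETTING (as in `AntitheticWedgeTransfer`).  `X` a finite partial order with a self-map `ι`, antipodal Kleitman (AK) in up-set form
`#(V ∩ ι Y) ≤ #(V ∩ Y)` for all up-sets `V, Y`.  The rearrangement inequality (R) of a polarized `(X,L)` is, in quadruple form,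
`#(A₂ ∩ ι B₃) + #(A₃ ∩ ι B₂) ≤ #(A₂ ∩ B₂) + #(A₃ ∩ B₃) + #((A₄ ∖ A₁) ∩ (B₄ ∖ B₁))` for T-pattern quadruples `𝐀 = (A₁,…,A₄)`, `𝐁` (sheets
`RB, RR, BB, BR` of the wedge gluing `T(X;L)`).  Call the inner pair `(A₂, A₃) = (A_RR, A_BB)` NESTED if `A₃ ⊆ A₂`, ANTI-NESTED if `A₂ ⊆ A₃`, CROSSING otherwise.
* `AntitheticWedgeNesting.cross_le_of_nested` — pure set bookkeeping: `A₃ ⊆ A₂`, `B₃ ⊆ B₂ ⟹ #(A₂ ∩ B₃) + #(A₃ ∩ B₂) ≤ #(A₂ ∩ B₂) + #(A₃ ∩ B₃)`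
  (the difference is `#((A₂ ∖ A₃) ∩ (B₂ ∖ B₃))`).
* `AntitheticWedgeNesting.card_nested_antinested`, `R_iff_nested_antinested` (g53 append) — for OPPOSITE types (`A₃ ⊆ A₂`, `B₂ ⊆ B₃`) the
  (R)-inequality is equivalent to `#((A₂∖A₃) ∩ (B₃∖B₂)) ≤ AKslack(A₂,B₃) + AKslack(A₃,B₂) + relays` — the form in which every known violation lives.
* `AntitheticWedgeNesting.R_of_same_nesting` — **on an AK base, (R) holds for every pair of quadruples whose inner pairs are both nested or both
  anti-nested**, with ANY outer sheets and without using `L` at all: two AK instances `#(A₂ ∩ ι B₃) ≤ #(A₂ ∩ B₃)`, `#(A₃ ∩ ι B₂) ≤ #(A₃ ∩ B₂)` and the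
  bookkeeping lemma.  CONSEQUENCES (memo §1–2): (i) a violation of (R) on an AK base (the W-fence at its middle atom, g49's four abstract villains, …)
  always pairs a nested with an anti-nested inner pair unless one of them is crossing — exact census: at W@middle ALL 5,967 violating admissible pairs
  `(B_RR, B_BB)` are comparable (5,494 nested, 473 anti-nested, 0 crossing) and each is violated by a partner of the opposite type (CONJECTURE C′ holds
  there and on the villains); (ii) one level up the tower, the outer-`M` part `τ_X(s₁,t₄;u₁,v₄)` of the (R)-functional of `T(T(X;L);L_T)` is always
  `≥ 0`, because the outer sheets of the two arguments are anti-nested (`s₁ ⊆ t₄`, `u₁ ⊆ v₄`).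
-/

namespace Summit.CriticalPhenomena.PercolationContinuityZ3.Theorems

open Finset

namespace AntitheticWedgeNesting

variable {X : Type*} [DecidableEq X]

/-- Bookkeeping: for `A₃ ⊆ A₂` and `B₃ ⊆ B₂`, `#(A₂ ∩ B₃) + #(A₃ ∩ B₂) ≤ #(A₂ ∩ B₂) + #(A₃ ∩ B₃)`. [this work] -/
theorem cross_le_of_nested (A₂ A₃ B₂ B₃ : Finset X) (hA : A₃ ⊆ A₂) (hB : B₃ ⊆ B₂) :
    (A₂ ∩ B₃).card + (A₃ ∩ B₂).card ≤ (A₂ ∩ B₂).card + (A₃ ∩ B₃).card := by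
  classical
  have e1 : (A₂ ∩ B₂).card = ((A₂ ∩ B₂).filter (fun x => x ∈ B₃)).card + ((A₂ ∩ B₂).filter (fun x => x ∉ B₃)).card := by
    rw [Finset.card_filter_add_card_filter_not]
  have e2 : (A₃ ∩ B₂).card = ((A₃ ∩ B₂).filter (fun x => x ∈ B₃)).card + ((A₃ ∩ B₂).filter (fun x => x ∉ B₃)).card := by
    rw [Finset.card_filter_add_card_filter_not]
  have i1 : (A₂ ∩ B₂).filter (fun x => x ∈ B₃) = A₂ ∩ B₃ := by
    ext x; simp only [Finset.mem_filter, Finset.mem_inter]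
    constructor
    · rintro ⟨⟨h1, _⟩, h3⟩; exact ⟨h1, h3⟩
    · rintro ⟨h1, h3⟩; exact ⟨⟨h1, hB h3⟩, h3⟩
  have i2 : (A₃ ∩ B₂).filter (fun x => x ∈ B₃) = A₃ ∩ B₃ := by
    ext x; simp only [Finset.mem_filter, Finset.mem_inter]
    constructor
    · rintro ⟨⟨h1, _⟩, h3⟩; exact ⟨h1, h3⟩
    · rintro ⟨h1, h3⟩; exact ⟨⟨h1, hB h3⟩, h3⟩
  have i3 : (A₃ ∩ B₂).filter (fun x => x ∉ B₃) ⊆ (A₂ ∩ B₂).filter (fun x => x ∉ B₃) := by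
    intro x hx
    simp only [Finset.mem_filter, Finset.mem_inter] at hx ⊢
    exact ⟨⟨hA hx.1.1, hx.1.2⟩, hx.2⟩
  have c3 := Finset.card_le_card i3
  rw [i1] at e1; rw [i2] at e2
  omega

/-- **(R) is automatic for pairs of the same nesting type on an AK base.**  `X` AK in up-set form for the self-map `ι` (`hAK`); `A₂, A₃, B₂, B₃`
up-sets with `(A₃ ⊆ A₂ ∧ B₃ ⊆ B₂) ∨ (A₂ ⊆ A₃ ∧ B₂ ⊆ B₃)`; then for ANY `A₁, A₄, B₁, B₄` the (R)-inequality
`#(A₂ ∩ ι B₃) + #(A₃ ∩ ι B₂) ≤ #(A₂ ∩ B₂) + #(A₃ ∩ B₃) + #((A₄ ∖ A₁) ∩ (B₄ ∖ B₁))` holds. [this work] -/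
theorem R_of_same_nesting [PartialOrder X] (ι : X → X)
    (hAK : ∀ V Y : Finset X, (∀ x y, x ≤ y → x ∈ V → y ∈ V) → (∀ x y, x ≤ y → x ∈ Y → y ∈ Y) →
      (V ∩ Y.image ι).card ≤ (V ∩ Y).card)
    (A₁ A₂ A₃ A₄ B₁ B₂ B₃ B₄ : Finset X)
    (hA₂ : ∀ x y, x ≤ y → x ∈ A₂ → y ∈ A₂) (hA₃ : ∀ x y, x ≤ y → x ∈ A₃ → y ∈ A₃)
    (hB₂ : ∀ x y, x ≤ y → x ∈ B₂ → y ∈ B₂) (hB₃ : ∀ x y, x ≤ y → x ∈ B₃ → y ∈ B₃)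
    (h : (A₃ ⊆ A₂ ∧ B₃ ⊆ B₂) ∨ (A₂ ⊆ A₃ ∧ B₂ ⊆ B₃)) :
    (A₂ ∩ B₃.image ι).card + (A₃ ∩ B₂.image ι).card ≤
      (A₂ ∩ B₂).card + (A₃ ∩ B₃).card + ((A₄ \ A₁) ∩ (B₄ \ B₁)).card := by
  have ak1 := hAK A₂ B₃ hA₂ hB₃
  have ak2 := hAK A₃ B₂ hA₃ hB₂
  rcases h with ⟨hA, hB⟩ | ⟨hA, hB⟩
  · have c := cross_le_of_nested A₂ A₃ B₂ B₃ hA hB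
    omega
  · have c := cross_le_of_nested A₃ A₂ B₃ B₂ hA hB
    omega

/-- Bookkeeping for OPPOSITE nesting types: for `A₃ ⊆ A₂` and `B₂ ⊆ B₃`,
`#(A₂ ∩ B₂) + #(A₃ ∩ B₃) + #((A₂ ∖ A₃) ∩ (B₃ ∖ B₂)) = #(A₂ ∩ B₃) + #(A₃ ∩ B₂)`. [this work, g53] -/
theorem card_nested_antinested (A₂ A₃ B₂ B₃ : Finset X) (hA : A₃ ⊆ A₂) (hB : B₂ ⊆ B₃) :
    (A₂ ∩ B₂).card + (A₃ ∩ B₃).card + ((A₂ \ A₃) ∩ (B₃ \ B₂)).card = (A₂ ∩ B₃).card + (A₃ ∩ B₂).card := by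
  classical
  -- split A₂ ∩ B₃ along membership in B₂, and the part outside B₂ along membership in A₃
  have e1 : (A₂ ∩ B₃).card = ((A₂ ∩ B₃).filter (fun x => x ∈ B₂)).card + ((A₂ ∩ B₃).filter (fun x => x ∉ B₂)).card := by
    rw [Finset.card_filter_add_card_filter_not]
  have e2 : ((A₂ ∩ B₃).filter (fun x => x ∉ B₂)).card =
      (((A₂ ∩ B₃).filter (fun x => x ∉ B₂)).filter (fun x => x ∈ A₃)).card +
      (((A₂ ∩ B₃).filter (fun x => x ∉ B₂)).filter (fun x => x ∉ A₃)).card := by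
    rw [Finset.card_filter_add_card_filter_not]
  have e3 : (A₃ ∩ B₃).card = ((A₃ ∩ B₃).filter (fun x => x ∈ B₂)).card + ((A₃ ∩ B₃).filter (fun x => x ∉ B₂)).card := by
    rw [Finset.card_filter_add_card_filter_not]
  have i1 : (A₂ ∩ B₃).filter (fun x => x ∈ B₂) = A₂ ∩ B₂ := by
    ext x; simp only [Finset.mem_filter, Finset.mem_inter]
    constructor
    · rintro ⟨⟨h1, _⟩, h3⟩; exact ⟨h1, h3⟩
    · rintro ⟨h1, h3⟩; exact ⟨⟨h1, hB h3⟩, h3⟩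
  have i2 : ((A₂ ∩ B₃).filter (fun x => x ∉ B₂)).filter (fun x => x ∈ A₃) = (A₃ ∩ B₃).filter (fun x => x ∉ B₂) := by
    ext x; simp only [Finset.mem_filter, Finset.mem_inter]
    constructor
    · rintro ⟨⟨⟨_, h2⟩, h3⟩, h4⟩; exact ⟨⟨h4, h2⟩, h3⟩
    · rintro ⟨⟨h1, h2⟩, h3⟩; exact ⟨⟨⟨hA h1, h2⟩, h3⟩, h1⟩
  have i3 : ((A₂ ∩ B₃).filter (fun x => x ∉ B₂)).filter (fun x => x ∉ A₃) = (A₂ \ A₃) ∩ (B₃ \ B₂) := by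
    ext x; simp only [Finset.mem_filter, Finset.mem_inter, Finset.mem_sdiff]
    constructor
    · rintro ⟨⟨⟨h1, h2⟩, h3⟩, h4⟩; exact ⟨⟨h1, h4⟩, ⟨h2, h3⟩⟩
    · rintro ⟨⟨h1, h4⟩, ⟨h2, h3⟩⟩; exact ⟨⟨⟨h1, h2⟩, h3⟩, h4⟩
  have i4 : (A₃ ∩ B₃).filter (fun x => x ∈ B₂) = A₃ ∩ B₂ := by
    ext x; simp only [Finset.mem_filter, Finset.mem_inter]
    constructor
    · rintro ⟨⟨h1, _⟩, h3⟩; exact ⟨h1, h3⟩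
    · rintro ⟨h1, h3⟩; exact ⟨⟨h1, hB h3⟩, h3⟩
  rw [i1] at e1; rw [i2, i3] at e2; rw [i4] at e3
  omega

/-- **(R) for pairs of OPPOSITE nesting type = where violations live (memo §2).**  For `A₃ ⊆ A₂` (nested) and `B₂ ⊆ B₃` (anti-nested) and any
`ι, A₁, A₄, B₁, B₄`, the (R)-inequality `#(A₂ ∩ ι B₃) + #(A₃ ∩ ι B₂) ≤ #(A₂ ∩ B₂) + #(A₃ ∩ B₃) + #((A₄ ∖ A₁) ∩ (B₄ ∖ B₁))` is EQUIVALENT to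
`#((A₂ ∖ A₃) ∩ (B₃ ∖ B₂)) ≤ [#(A₂ ∩ B₃) − #(A₂ ∩ ι B₃)] + [#(A₃ ∩ B₂) − #(A₃ ∩ ι B₂)] + #((A₄ ∖ A₁) ∩ (B₄ ∖ B₁))`: the overlap of the nested gap
with the anti-nested gap must be paid by two AK slacks and the relay term (stated without subtraction). [this work, g53] -/
theorem R_iff_nested_antinested (ι : X → X) (A₁ A₂ A₃ A₄ B₁ B₂ B₃ B₄ : Finset X) (hA : A₃ ⊆ A₂) (hB : B₂ ⊆ B₃) :
    (A₂ ∩ B₃.image ι).card + (A₃ ∩ B₂.image ι).card ≤ (A₂ ∩ B₂).card + (A₃ ∩ B₃).card + ((A₄ \ A₁) ∩ (B₄ \ B₁)).card ↔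
      ((A₂ \ A₃) ∩ (B₃ \ B₂)).card + (A₂ ∩ B₃.image ι).card + (A₃ ∩ B₂.image ι).card ≤
        (A₂ ∩ B₃).card + (A₃ ∩ B₂).card + ((A₄ \ A₁) ∩ (B₄ \ B₁)).card := by
  have e := card_nested_antinested A₂ A₃ B₂ B₃ hA hB
  omega

end AntitheticWedgeNesting

end Summit.CriticalPhenomena.PercolationContinuityZ3.Theorems
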